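import Summits.Langlands.Langlands.Theses.BrauerHeilbronnDescent
import Literature.NumberTheory.Automorphic.AutomorphicRepsGLLogDetCounterexample
import Literature.NumberTheory.Automorphic.ClozelAlgebraicityRankOne

/-! # Disproof of `AutToGalResidual` — findings: NO KILL (crux-attack at birth, 2026-08-17)

Crux `stmt-Langlands-19255` of `route-Langlands-BrauerHeilbronnDescent`:
`AutToGalResidual := ∀ F R n, 0 < n → ∀ hcpt, AutomorphicToGalois n R hcpt` — declared RESIDUAL.

Findings (refuter-rattack-stmt-Langlands-19255-0):
* ELABORATES (rc 0). It is LITERALLY the (A)-projection of the audited summit `Langlands`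
  (same binder order `∀ F, ∀ R, ∀ n, 0 < n → ∀ hcpt`): `summit_implies_residual` (S → C) and
  `residual_and_B_iff` (C ∧ ⟨Nonempty R, (B)⟩ ↔ S) below, both `rfl`-level logic. C → S alone is
  not provable (it is (B) + non-vacuity). No hidden extra strength, no dropped hypothesis relative
  to the summit conjunct; a refutation of C would refute the summit itself.
* TRIVIALITY (3a): `simp` / `aesop` / `trivial` do not close it (open problem: Buzzard–Gee 2014
  Conj. 3.2.1/3.2.2 for `G = GL_n`, p. 14 of arXiv:1009.0785, all `n`, all number fields).
* VACUITY (3b) of the binders: `hcpt` is inhabited (`isCompact_glFiniteIntegralLevel_holds`,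
  proved); `π : CuspidalAutomorphicRepData 1 F hcpt` is inhabited for every `F` (Borel–Jacquet line
  of any Hecke character, `exists_cuspidal_detTwist_glOne`; also the non-split `π_log`,
  `exists_cuspidalAutomorphicRepData_gl_one_span_logDet`) — witnesses below; `R : ReciprocityData F`
  is NOT constructible in the tree (shared open item stmt-Langlands-17930 `ReciprocityDataExist`;
  in print Harris–Taylor 2001 Thm. A + LCFT) — were it empty, C would be vacuously TRUE and the
  summit FALSE through its `Nonempty` conjunct (documented fail-safe of the statement audit
  2026-08-16), so this is not a defect of the crux.
* DEGENERATE CASES: `n = 0` is excluded by the guard `0 < n` (guard is load-bearing: at `n = 0`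
  the datum `ℂ·1/0` on `GL_0` is cuspidal and L-algebraic — `hasArchParameter_rank_zero` — while
  no `ρ : Γ_F → GL_0` is irreducible, cf. the refutation of stmt-Langlands-17212; a proof of
  `¬ AutToGalResidual`-without-the-guard needs an `R`, i.e. is only available modulo
  `Nonempty (ReciprocityData F)`). `n = 1` is Weil 1956 / Serre (algebraic Hecke characters ↔
  ℓ-adic characters; tree: `HeckeCharacter.IsAlgebraic.exists_lAdic`,
  `HarrisLanTaylorThorne2016.theoremA_existence_rank_one`) — true in print, no junk: rank-one
  Satake parameters are unique in-tree (`exists_eq_singleton_of_hasSatakeParamAt_glOne`).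
* QUANTIFIER ORDER vs BG Conj. 3.2.1: exceptional set `S` bound inside `∃ ρ` (`∀ᶠ v in cofinite`)
  ✓; `∀ ℓ ι` ✓; uniqueness clause quantifies over ALL corresponding `ρ'` (not only irreducible
  ones) — harmless: Satake uniqueness + Chebotarev + Brauer–Nesbitt give `ρ'^ss ≅ ρ`, and a
  representation whose semisimplification is irreducible is irreducible, so `ρ' ≅ ρ`, conjugate in
  `GL_n(ℚ̄_ℓ)` (BG Rem. 3.2.4's non-uniqueness concerns non-cuspidal π / non-split `G`).
* CARRIERS: `PadicAlgCl ℓ` is Mathlib's normed `ℚ̄_ℓ` (genuine topology, continuity is not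
  vacuous); `FramedGaloisRep` = continuous `Γ_F →ₜ* GL_n`; `AutomorphicRepData` = Borel–Jacquet
  `W'/W` datum (irreducible subquotient of automorphic forms; no `A_G` condition, hence non-split
  data such as `π_log`, which only changes the realisation, not `W/W'`); `Corresponds` is a
  conjunctive `∃` at every finite place (unsatisfiable interface ⇒ C false, never trivially true).
* CHEAP FALSITY: not finite/decidable; no compute. Nothing in `ledger negatives --problem Langlands`
  (16951, 16822, 17212, 3797) touches `AutomorphicToGalois`.
Verdict: survives; difficulty = the summit's direction (A) in full (NonRegularWeightBarrier,
ShimuraVarietyRealizationBarrier apply to PROVING it, not to its truth).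
-/

set_option linter.dupNamespace false

namespace Summit.Langlands.Langlands.Cruxes.AutToGalResidual.Disproof

open Summit.Langlands.Langlands.Theses.BrauerHeilbronnDescent
open Literature.NumberTheory.Automorphic

/-- S → C: the summit implies the residual crux (it is conjunct (A)). [folklore] -/
theorem summit_implies_residual : _root_.Langlands → AutToGalResidual :=
  fun h F _ _ R n hn hcpt => ((h F).2 R n hn hcpt).1

/-- C ∧ (non-vacuity ∧ (B)) ↔ S: the residual is exactly the (A)-half of the summit. [folklore] -/
theorem residual_and_B_iff :
    (AutToGalResidual ∧ (∀ (F : Type) [Field F] [NumberField F],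
      Nonempty (Summit.Langlands.ReciprocityData F) ∧
      ∀ (R : Summit.Langlands.ReciprocityData F) (n : ℕ), 0 < n →
        ∀ hcpt : isCompact_glFiniteIntegralLevel n F,
          Summit.Langlands.GaloisToAutomorphic n R hcpt)) ↔ _root_.Langlands := by
  constructor
  · rintro ⟨hA, hB⟩ F _ _
    exact ⟨(hB F).1, fun R n hn hcpt => ⟨hA F R n hn hcpt, (hB F).2 R n hn hcpt⟩⟩
  · intro h
    exact ⟨fun F _ _ R n hn hcpt => ((h F).2 R n hn hcpt).1,
      fun F _ _ => ⟨(h F).1, fun R n hn hcpt => ((h F).2 R n hn hcpt).2⟩⟩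

/-- The guard `0 < n` is really in the statement (definitional unfolding). [folklore] -/
theorem autToGalResidual_iff : AutToGalResidual ↔
    ∀ (F : Type) [Field F] [NumberField F] (R : Summit.Langlands.ReciprocityData F) (n : ℕ), 0 < n →
      ∀ hcpt : isCompact_glFiniteIntegralLevel n F, Summit.Langlands.AutomorphicToGalois n R hcpt :=
  Iff.rfl

/-- Non-vacuity of the `hcpt` binder (proved compactness of `GL_n(𝒪̂)`). [folklore] -/
theorem hcpt_inhabited (n : ℕ) (F : Type) [Field F] [NumberField F] :
    isCompact_glFiniteIntegralLevel n F :=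
  isCompact_glFiniteIntegralLevel_holds n F

/-- Non-vacuity of the `π` binder in rank one: the Borel–Jacquet line of a Hecke character is a
cuspidal datum on `GL_1(𝔸_F)`. [folklore] -/
theorem cuspidal_rank_one_nonempty (F : Type) [Field F] [NumberField F]
    (θ : Literature.NumberTheory.GaloisRepresentations.HeckeCharacter F)
    (hcpt : isCompact_glFiniteIntegralLevel 1 F) :
    Nonempty (CuspidalAutomorphicRepData 1 F hcpt) := by
  obtain ⟨π, -, -⟩ := exists_cuspidal_detTwist_glOne hcpt θ
  exact ⟨π⟩

/-- … and the non-split junk-shaped datum `π_log = span{log‖·‖, 1}/ℂ·1` is one too (same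
`W/W'` = trivial character; it changes the realisation only). [folklore] -/
theorem cuspidal_rank_one_nonempty_logDet (F : Type) [Field F] [NumberField F]
    (hcpt : isCompact_glFiniteIntegralLevel 1 F) :
    Nonempty (CuspidalAutomorphicRepData 1 F hcpt) := by
  obtain ⟨π, -, -⟩ := exists_cuspidalAutomorphicRepData_gl_one_span_logDet (K := F) (hcpt := hcpt)
  exact ⟨π⟩

end Summit.Langlands.Langlands.Cruxes.AutToGalResidual.Disproof
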